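import Summits.QuantumFields.YangMills.Theorems.LuscherReductionTwistedTraceScalingBTRatesKappa
import HarnessLib

/-!
# (B-T) FOR AN ARBITRARY PROFILE, part 2: the algebraic envelopes of `ε₁`, `ε₂`, `η` under the weaker fibre-radius hypothesis `βR² ≤ ℓ²`
# (lane A of S-BASE, crux `TwistedTraceScaling` stmt-QuantumFields-20203, C4-CORE, the (B-T) pen; design note `pub/ym-fleet/ym-luscher-20007-p1/COARSE-DESIGN.md` §26)

Schedule B (`…BTProfileRates`) lets the fibre profile live out to radius `β^{-1/2}·log β` (so that a truncated frozen stiff Gaussian qualifies), hence `βR² ≤ log²β` instead of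
`βR² ≤ 1`.  This file re-proves the three algebraic envelopes of `…BTRatesCore` under `βR² ≤ ℓ²` with the SAME constants: `coreEps1_le_atom'` (`ε₁ ≤ 14(288|E|A+160N_P)·pℓ²`),
`coreEps2_le_atom'`, `coreEta_le_atom'` (`≤ K·(p²+x)ℓ⁴`); pure polynomial inequalities in abstract nonnegative reals.
HONEST FRAMING: a stub of a child of the CONDITIONAL reduction route R2b1; C4-CORE OPEN ((B-ST), (B-OD)); not infinite volume, not a gap, not Clay.
-/

set_option autoImplicit false

noncomputable section

open MeasureTheory Filter Topology Real Asymptotics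
open scoped BigOperators
open Literature.MathematicalPhysics.QuantumFieldTheory
open Literature.MathematicalPhysics.QuantumLattice

namespace Summit.QuantumFields.YangMills.Theorems.FemtoTransferGap.TwoLattice.ConstTube

open Summit.QuantumFields.YangMills.Theorems.FemtoTransferGap
open Summit.QuantumFields.YangMills.Theorems.FemtoTransferGap.TwoLattice
open Summit.QuantumFields.YangMills.Theorems.FemtoTransferGap.TwoLattice.Cov

variable {L : ℕ} [NeZero L]

/-! ## §1 The envelopes under `βR² ≤ ℓ²` -/

/-- **Envelope of `ε₁`** under the weaker fibre-radius hypothesis `βR² ≤ ℓ²`: `ε₁ ≤ 14(288|E|A + 160 N_P)·pℓ²`. [folklore] -/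
theorem coreEps1_le_atom' {β δ T R p ℓ A : ℝ} (hβ : 0 ≤ β) (hδ0 : 0 ≤ δ) (hδ : δ ≤ 14 * p) (hT2 : β * T ^ 2 ≤ A * ℓ ^ 2) (hR2 : β * R ^ 2 ≤ ℓ ^ 2) :
    coreEps1 L β δ T R ≤ 14 * (288 * (Fintype.card (Edge 3 L) : ℝ) * A + 160 * (Fintype.card (Plaquette 3 L × Fin 3) : ℝ)) * (p * ℓ ^ 2) := by
  unfold coreEps1
  set E := (Fintype.card (Edge 3 L) : ℝ)
  set NP := (Fintype.card (Plaquette 3 L × Fin 3) : ℝ)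
  have hE : 0 ≤ E := Nat.cast_nonneg _
  have hNP : 0 ≤ NP := Nat.cast_nonneg _
  have hp0 : 0 ≤ p := by linarith
  have hA : 0 ≤ A * ℓ ^ 2 := le_trans (by positivity) hT2
  have k1 : δ * (β * T ^ 2) ≤ 14 * p * (A * ℓ ^ 2) := mul_le_mul hδ hT2 (by positivity) (by positivity)
  have k2 : δ * (β * R ^ 2) ≤ 14 * p * ℓ ^ 2 := mul_le_mul hδ hR2 (by positivity) (by positivity)
  calc β * (12 * (E * (2 * δ * T * (12 * T)))) + β * (40 * (2 * δ) * NP * (R ^ 2 + R ^ 2))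
        = 288 * E * (δ * (β * T ^ 2)) + 160 * NP * (δ * (β * R ^ 2)) := by ring
    _ ≤ 288 * E * (14 * p * (A * ℓ ^ 2)) + 160 * NP * (14 * p * ℓ ^ 2) :=
        add_le_add (mul_le_mul_of_nonneg_left k1 (by positivity)) (mul_le_mul_of_nonneg_left k2 (by positivity))
    _ = 14 * (288 * E * A + 160 * NP) * (p * ℓ ^ 2) := by ring

/-- **Envelope of `ε₂`** under `βR² ≤ ℓ²`: `ε₂ ≤ K₂(L, A)·(p² + x)ℓ⁴` (same constant). [folklore] -/
theorem coreEps2_le_atom' {β δ T R σ p x ℓ A : ℝ} (hβ : 0 ≤ β) (hδ0 : 0 ≤ δ) (hδ : δ ≤ 14 * p) (hℓ : 1 ≤ ℓ) (hx0 : 0 ≤ x) (hx1 : x ≤ 1)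
    (hT0 : 0 ≤ T) (hTx : T ≤ 46 * L * x * ℓ) (hT2 : β * T ^ 2 ≤ A * ℓ ^ 2) (hA : 0 ≤ A) (hR2 : β * R ^ 2 ≤ ℓ ^ 2)
    (hσδ : σ ≤ 12 * (L : ℝ) ^ 3 * δ ^ 2) (hsσ : Real.sqrt σ ≤ 4 * (L : ℝ) ^ 2 * δ ^ 2) :
    coreEps2 L β δ T R σ ≤
      (576 * 196 * (Fintype.card (Edge 3 L) : ℝ) * A + 50 * (12 * 196 * (L : ℝ) ^ 3) * (Fintype.card (Plaquette 3 L × Fin 3) : ℝ) +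
          (Fintype.card (Plaquette 3 L) : ℝ) * (1728 * (4 * 196 * A * (L : ℝ) ^ 2) + 29376 * (46 * A * L) + 700569 * (2116 * A * (L : ℝ) ^ 2)) +
          (Fintype.card (Plaquette 3 L) : ℝ) * (29376 * (46 * A * L) + 700569 * (2116 * A * (L : ℝ) ^ 2)) +
          145000000 * 196 * (Fintype.card (Plaquette 3 L × Fin 3) : ℝ)) *
        ((p ^ 2 + x) * ℓ ^ 4) := by
  obtain ⟨hW1, -, -, -, -, -⟩ := atoms_le_W (p := p) hx0 hℓ
  obtain ⟨kc, kd⟩ := stepTerms_le_atom (β := β) (σ := σ) hδ0 hδ hℓ hx0 hx1 hT0 hTx hT2 hA hsσ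
  set W := (p ^ 2 + x) * ℓ ^ 4 with hWdef
  set E := (Fintype.card (Edge 3 L) : ℝ)
  set NP := (Fintype.card (Plaquette 3 L × Fin 3) : ℝ)
  set Npl := (Fintype.card (Plaquette 3 L) : ℝ)
  have hE : 0 ≤ E := Nat.cast_nonneg _
  have hNP : 0 ≤ NP := Nat.cast_nonneg _
  have hNpl : 0 ≤ Npl := Nat.cast_nonneg _
  have hL0 : (0 : ℝ) ≤ L := Nat.cast_nonneg _
  have hp0 : 0 ≤ p := by linarith
  have hW0 : 0 ≤ W := by positivity
  have hδ2 : δ ^ 2 ≤ 196 * p ^ 2 :=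
    calc δ ^ 2 ≤ (14 * p) ^ 2 := pow_le_pow_left₀ hδ0 hδ 2
      _ = 196 * p ^ 2 := by ring
  have hβT : 0 ≤ β * T ^ 2 := by positivity
  have hβR : 0 ≤ β * R ^ 2 := by positivity
  have hsq : Real.sqrt NP ^ 2 = NP := Real.sq_sqrt hNP
  -- the exact decomposition
  have hdec : coreEps2 L β δ T R σ = 576 * E * (δ ^ 2 * (β * T ^ 2)) + 50 * NP * (σ * (β * R ^ 2)) +
      Npl * (1728 * (β * T ^ 2 * Real.sqrt σ) + 29376 * (β * T ^ 2 * T) + 700569 * (β * T ^ 2 * T ^ 2)) +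
      Npl * (29376 * (β * T ^ 2 * T) + 700569 * (β * T ^ 2 * T ^ 2)) + 145000000 * NP * (δ ^ 2 * (β * R ^ 2)) := by
    unfold coreEps2 stepActionErr
    rw [Real.sqrt_zero]
    linear_combination (50 * β * σ * R ^ 2) * hsq
  have ka : δ ^ 2 * (β * T ^ 2) ≤ 196 * A * W :=
    calc δ ^ 2 * (β * T ^ 2) ≤ 196 * p ^ 2 * (A * ℓ ^ 2) := mul_le_mul hδ2 hT2 hβT (by positivity)
      _ = 196 * A * (p ^ 2 * ℓ ^ 2) := by ring
      _ ≤ 196 * A * W := mul_le_mul_of_nonneg_left hW1 (by positivity)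
  have kb : σ * (β * R ^ 2) ≤ 12 * 196 * (L : ℝ) ^ 3 * W :=
    calc σ * (β * R ^ 2) ≤ 12 * (L : ℝ) ^ 3 * δ ^ 2 * ℓ ^ 2 := mul_le_mul hσδ hR2 hβR (by positivity)
      _ ≤ 12 * (L : ℝ) ^ 3 * (196 * p ^ 2) * ℓ ^ 2 := by gcongr
      _ = 12 * 196 * (L : ℝ) ^ 3 * (p ^ 2 * ℓ ^ 2) := by ring
      _ ≤ 12 * 196 * (L : ℝ) ^ 3 * W := mul_le_mul_of_nonneg_left hW1 (by positivity)
  have ke : δ ^ 2 * (β * R ^ 2) ≤ 196 * W :=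
    calc δ ^ 2 * (β * R ^ 2) ≤ 196 * p ^ 2 * ℓ ^ 2 := mul_le_mul hδ2 hR2 hβR (by positivity)
      _ = 196 * (p ^ 2 * ℓ ^ 2) := by ring
      _ ≤ 196 * W := mul_le_mul_of_nonneg_left hW1 (by norm_num)
  rw [hdec]
  have hsum := add_le_add (add_le_add (add_le_add (add_le_add (mul_le_mul_of_nonneg_left ka (show 0 ≤ 576 * E by positivity))
    (mul_le_mul_of_nonneg_left kb (show 0 ≤ 50 * NP by positivity))) (mul_le_mul_of_nonneg_left kc hNpl))
    (mul_le_mul_of_nonneg_left kd hNpl)) (mul_le_mul_of_nonneg_left ke (show 0 ≤ 145000000 * NP by positivity))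
  refine hsum.trans (le_of_eq ?_)
  ring

/-- **Envelope of `η`** under `βR² ≤ ℓ²`: `η ≤ K₃(L, A, N)·(p² + x)ℓ⁴` (same constant). [folklore] -/
theorem coreEta_le_atom' {β δ α T R Γ σ p x ℓ A N : ℝ} (hβ : 0 ≤ β) (hδ0 : 0 ≤ δ) (hδ : δ ≤ 14 * p) (hδ1 : δ ≤ 1) (hℓ : 1 ≤ ℓ) (hx0 : 0 ≤ x)
    (hx1 : x ≤ 1) (hT0 : 0 ≤ T) (hTx : T ≤ 46 * L * x * ℓ) (hT2 : β * T ^ 2 ≤ A * ℓ ^ 2) (hA : 0 ≤ A)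
    (hR2 : β * R ^ 2 ≤ ℓ ^ 2) (hσδ : σ ≤ 12 * (L : ℝ) ^ 3 * δ ^ 2) (hsσ : Real.sqrt σ ≤ 4 * (L : ℝ) ^ 2 * δ ^ 2) (hα0 : 0 ≤ α) (hα : α ≤ x * ℓ)
    (hΓ0 : 0 ≤ Γ) (hΓ : β * Γ ≤ N) (hN : 0 ≤ N) :
    coreEta L β δ α T R Γ σ ≤
      ((Fintype.card (Edge 3 L) : ℝ) * (558 * A + 192 * A) + 216 * N + 50 * (Fintype.card (Plaquette 3 L × Fin 3) : ℝ) * (12 * 196 * (L : ℝ) ^ 3) +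
          (Fintype.card (Plaquette 3 L) : ℝ) * (1728 * (4 * 196 * A * (L : ℝ) ^ 2) + 29376 * (46 * A * L) + 700569 * (2116 * A * (L : ℝ) ^ 2)) +
          5040 * (Fintype.card (Plaquette 3 L × Fin 3) : ℝ)) * ((p ^ 2 + x) * ℓ ^ 4) := by
  obtain ⟨hW1, hW2, hW3, hW4, -, -⟩ := atoms_le_W (p := p) hx0 hℓ
  set W := (p ^ 2 + x) * ℓ ^ 4 with hWdef
  set E := (Fintype.card (Edge 3 L) : ℝ)
  set NP := (Fintype.card (Plaquette 3 L × Fin 3) : ℝ)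
  set Npl := (Fintype.card (Plaquette 3 L) : ℝ)
  have hE : 0 ≤ E := Nat.cast_nonneg _
  have hNP : 0 ≤ NP := Nat.cast_nonneg _
  have hNpl : 0 ≤ Npl := Nat.cast_nonneg _
  have hL0 : (0 : ℝ) ≤ L := Nat.cast_nonneg _
  have hp0 : 0 ≤ p := by linarith
  have hℓ0 : 0 ≤ ℓ := by linarith
  have hW0 : 0 ≤ W := by positivity
  have hδ2 : δ ^ 2 ≤ 196 * p ^ 2 := by nlinarith
  have hxℓ0 : 0 ≤ x * ℓ := by positivity
  have hβT : 0 ≤ β * T ^ 2 := by positivity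
  have hβR : 0 ≤ β * R ^ 2 := by positivity
  have hdec : coreEta L β δ α T R Γ σ = E * (558 * (α ^ 2 * (β * T ^ 2)) + 192 * (α * (β * T ^ 2))) + 216 * (α * δ * (β * Γ)) +
      50 * NP * (σ * (β * R ^ 2)) + Npl * (1728 * (β * T ^ 2 * Real.sqrt σ) + 29376 * (β * T ^ 2 * T) + 700569 * (β * T ^ 2 * T ^ 2)) +
      5040 * NP * (α * (β * R ^ 2)) := by
    unfold coreEta stepActionErr; ring
  have k1 : α ^ 2 * (β * T ^ 2) ≤ A * W := by
    have hα2 : α ^ 2 ≤ x * ℓ ^ 2 := by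
      calc α ^ 2 ≤ (x * ℓ) ^ 2 := pow_le_pow_left₀ hα0 hα 2
        _ = x * x * ℓ ^ 2 := by ring
        _ ≤ 1 * x * ℓ ^ 2 := by gcongr
        _ = x * ℓ ^ 2 := by ring
    calc α ^ 2 * (β * T ^ 2) ≤ x * ℓ ^ 2 * (A * ℓ ^ 2) := mul_le_mul hα2 hT2 hβT (by positivity)
      _ = A * (x * ℓ ^ 4) := by ring
      _ ≤ A * W := mul_le_mul_of_nonneg_left hW3 hA
  have k2 : α * (β * T ^ 2) ≤ A * W :=
    calc α * (β * T ^ 2) ≤ x * ℓ * (A * ℓ ^ 2) := mul_le_mul hα hT2 hβT hxℓ0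
      _ = A * (x * ℓ ^ 3) := by ring
      _ ≤ A * W := mul_le_mul_of_nonneg_left hW2 hA
  have k3 : α * δ * (β * Γ) ≤ N * W := by
    have h1 : α * δ ≤ x * ℓ * 1 := mul_le_mul hα hδ1 hδ0 hxℓ0
    calc α * δ * (β * Γ) ≤ x * ℓ * 1 * N := mul_le_mul h1 hΓ (by positivity) (by positivity)
      _ = N * (x * ℓ) := by ring
      _ ≤ N * W := mul_le_mul_of_nonneg_left hW4 hN
  have k4 : σ * (β * R ^ 2) ≤ 12 * 196 * (L : ℝ) ^ 3 * W :=
    calc σ * (β * R ^ 2) ≤ 12 * (L : ℝ) ^ 3 * δ ^ 2 * ℓ ^ 2 := mul_le_mul hσδ hR2 hβR (by positivity)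
      _ ≤ 12 * (L : ℝ) ^ 3 * (196 * p ^ 2) * ℓ ^ 2 := by gcongr
      _ = 12 * 196 * (L : ℝ) ^ 3 * (p ^ 2 * ℓ ^ 2) := by ring
      _ ≤ 12 * 196 * (L : ℝ) ^ 3 * W := mul_le_mul_of_nonneg_left hW1 (by positivity)
  obtain ⟨k5, -⟩ := stepTerms_le_atom (β := β) (σ := σ) hδ0 hδ hℓ hx0 hx1 hT0 hTx hT2 hA hsσ
  rw [← hWdef] at k5
  have k6 : α * (β * R ^ 2) ≤ W :=
    calc α * (β * R ^ 2) ≤ x * ℓ * ℓ ^ 2 := mul_le_mul hα hR2 hβR hxℓ0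
      _ = x * ℓ ^ 3 := by ring
      _ ≤ W := hW2
  rw [hdec]
  have hsum := add_le_add (add_le_add (add_le_add (add_le_add
    (mul_le_mul_of_nonneg_left (add_le_add (mul_le_mul_of_nonneg_left k1 (show (0 : ℝ) ≤ 558 by norm_num))
      (mul_le_mul_of_nonneg_left k2 (show (0 : ℝ) ≤ 192 by norm_num))) hE)
    (mul_le_mul_of_nonneg_left k3 (show (0 : ℝ) ≤ 216 by norm_num)))
    (mul_le_mul_of_nonneg_left k4 (show 0 ≤ 50 * NP by positivity))) (mul_le_mul_of_nonneg_left k5 hNpl))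
    (mul_le_mul_of_nonneg_left k6 (show 0 ≤ 5040 * NP by positivity))
  refine hsum.trans (le_of_eq ?_)
  ring

end Summit.QuantumFields.YangMills.Theorems.FemtoTransferGap.TwoLattice.ConstTube

end
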